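import Literature.MathematicalPhysics.QuantumFieldTheory.Balaban1983to89.B8CentreOscDescentRec

/-!
# `Balaban1983to89.B8PointwiseOscFromFineBondsRec` — [Balaban1985RegularSpaces] (1.135) p. 99 ∕ [Balaban1985Averaging] (166)–(167) p. 44: THE ADJACENT-CENTRE LETTERS OF A GAUGE
# FUNCTION FROM ITS FINE-BOND LETTERS UNDER A CELL, AND FROM A GAUGE RELATION `F = W^{u⁻¹}` — the elementary telescoping that feeds ✓p755045 `pointwise_osc_of_adjacent_centres` ((σ1) of the
# K0-road junction: the `hptu` binder of ✓p759262 §4 ∕ INTENT-31 for the pre-composed crown's `u₀ = h·um`)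

statement-level skeleton of published theorems with citation tags; proofs where landed; nothing here is a claim about the Yang–Mills mass gap

CITATION HEADER (lean-in-tree rule).  Cell `pub-ymgap` (HUMAN RULING D-0062), seat `pub-ymgap-dag-n07-e` g32 (FAN-OUT §N07 row s3; dag-n07-w3 g13 ASK-5, cell bus 2026-08-30 04:25Z).
[6] = [Balaban1985RegularSpaces] (1.135) p. 99 («`U₁ = U₀″^{u⁻¹}`: the gauge function relating two small fields»), (1.29) p. 81; [3] = [Balaban1985Averaging] (8) p. 18 (gauge action),
(166)–(167) p. 44, (180)–(182) p. 46; [I] = [Balaban1987RG1] (0.3) p. 252 (centred blocks).  `--kind proof --supports stmt-QuantumFields-20541` (K0⁷; count-neutral; no definition).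
REUSED BY NAME: ✓p755045 `B8CentreOscDescentRec.pointwise_osc_of_adjacent_centres`; dag-n05-d's `B8Eq119TwistedAxialRec.UnderZ`; dag-n05-e's `B8BlockConstantLiftStabilityRec.{underZ_add,
underZ_pow_smul}`; `B7Prop1Explicit.{gaugeAct, e}`; `B7Prop2Explicit.{unitaryUnits, unitaryUnits_le_U1}`; `BlockAveragingZd.{ctrShift, two_mul_ctrShift_add_one}`.

WHY.  ✓p755045 descends ADJACENT-CENTRE letters `b(n)` («`‖u(Lⁿa)⁻¹u(Lⁿ(a + e_μ)) − 1‖ ≤ b(n)` for block points `a, a + e_μ` of a sub-cell») to the pointwise multiscale oscillation `hptu`;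
what the pre-composed crown hands the junction (dag-n07-e ✓p760315 `hJ`) is instead BOND data: `F := c.fixed V um = (c.dprime V)^{um⁻¹}` by DEFINITION ([6] p. 99), with `F`'s bonds
`exp(ηA)`, `|ηA| ≤ r·L^{−j″}` on the sides touching `Ω′_{j″}` (the (1.38) log rows), and `W := c.dprime V` the cut axial field.  The gauge relation gives, bond by bond,
`‖um(x)⁻¹um(x + e_μ) − 1‖ ≤ ‖W(x,μ) − 1‖ + ‖F(x,μ) − 1‖` (§2), a straight segment of `Lⁿ` fine bonds joins adjacent level-`n` centres inside the sub-cell (§1, §3: `b(n) = Lⁿ·δ`), and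
✓p755045 turns `b(n) = Lⁿδ` into `hptu` with `ω := 2·d·s·δ·L^{j−1}`, `θ := L⁻¹` (§4); a block-constant left factor `h` (the junction's pre-composition, constant on the tower under the cell)
does not change the oscillation under the cell (§5: `u₀ = h·um`).  The two fine-bond letters `δ_W`, `δ_F` under the cell stay DISPLAYED (the level-scaled (1.35) for `W` and the
exponential of the log rows for `F` are the callers').

WHAT IS PROVED (sorry-free; C⋆-algebra carrier, unitarity only where used).
§1 ★ `norm_inv_mul_sub_one_le_of_segment` — unitary telescoping along a straight segment of `m` fine bonds: per-bond letters `δ` ⇒ `‖u(x)⁻¹u(x + m·e_μ) − 1‖ ≤ m·δ`;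
   ★ `norm_inv_mul_sub_one_le_sum_of_segment` — the weighted form `≤ Σ_{t<m} δ t` (face-level-dependent letters).
§2 ★★ `norm_inv_mul_shift_sub_one_le_of_gaugeAct` — `‖u(x)⁻¹u(x + e_μ) − 1‖ ≤ ‖W(x,μ) − 1‖ + ‖(W^{u⁻¹})(x,μ) − 1‖` (`gaugeAct u⁻¹ W x μ = u(x)⁻¹·W(x,μ)·u(x + e_μ)`, [3] (8)).
§3 ★★ `adjacent_centre_letters_of_fineBonds` — fine-bond letters `δ` under the cell `y` (depth `j`) ⇒ ✓p755045's `hadj` with `b(n) := Lⁿ·δ` (the segment stays under the sub-cell: centred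
   block arithmetic `2·c_m + 1 = L^m`); ★★ `adjacent_centre_letters_of_weightedFineBonds` — per-bond weights `wt` + segment sums `≤ b(n)` ⇒ `hadj` with `b` (the face-counting form:
   a hierarchical axial gauge jumps by `≈ α₀L^{2(m+2−k)}` across a level-`m` face, so uniform letters are lossy for high cells and the caller counts faces along the segment).
§4 ★★★ `pointwise_osc_of_fineBonds` — fine-bond letters ⇒ `hptu`: `‖u(L^{i+1}z)⁻¹u(w) − 1‖ ≤ ω·θ^{j−(i+1)}`, `ω := 2·d·s·δ·L^{j−1}`, `θ := L⁻¹` (`L = 2s+1 ≥ 3`).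
§5 ★★ `pointwise_osc_mul_left_of_blockConstant` — `h` constant on the tower under `y` ⇒ the `hptu` rows of `um` are those of `h·um`; ★★★ `pointwise_osc_of_fineBonds_of_gaugeAct` — §2+§4+§5
   combined: unitarity of `um`, `W` under the cell, the two bond letters `δ_W` (for `W`) and `δ_F` (for `W^{um⁻¹}`) under the cell, `h` block-constant ⇒ `hptu` for `h·um`;
   ★★★ `pointwise_osc_of_fineBonds_precomposed` — the same read for `u₀` and `um := h⁻¹·u₀` (the junction's letters).
HONEST FRAMING: count-neutral helper; elementary telescoping ∕ centred-block arithmetic — nothing of [6]∕[3]∕[I] asserted or discharged; the fine-bond letters `δ_W` (level-scaled (1.35)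
for the cut axial field) and `δ_F` (from the (1.38) log rows) are NOT produced here; `HThm4RecSym152PhiEG` ∕ `HThm4Rec*` UNDISCHARGED; N07 ∕ N05 NOT discharged; K0⁷ ∕ K1⁹ NOT closed;
counts unmoved; one finite 𝕋⁴ programme at fixed ε — R4 closes the conditional finite-𝕋⁴ rung `BalabanLadder.UV` only; the YM mass gap (Clay) is NOT proved by any of this; nothing
continuum ∕ ℝ⁴ ∕ OS.  No `def`, no `sorry`, no `instance`, no `notation`.
-/

set_option autoImplicit false

noncomputable section

open scoped BigOperators

namespace Literature.MathematicalPhysics.QuantumFieldTheory.Balaban1983to89.B8PointwiseOscFromFineBondsRec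

open B7Prop1Explicit hiding Site
open B7Prop1Explicit renaming Site → SiteZ
open B8Eq119TwistedAxialRec (UnderZ)
open B8BlockConstantLiftStabilityRec (underZ_add underZ_pow_smul)
open B7Prop2Explicit (unitaryUnits mem_unitaryUnits unitaryUnits_le_U1)
open BlockAveragingZd (ctrShift two_mul_ctrShift_add_one)
open B8CentreOscDescentRec (pointwise_osc_of_adjacent_centres)

variable {d : ℕ}

section Main

variable {𝔹 : Type*} [CStarAlgebra 𝔹] [Nontrivial 𝔹]

omit [Nontrivial 𝔹] in
/-- `‖X·Y − 1‖ ≤ ‖X − 1‖ + ‖Y − 1‖` when `‖X‖ ≤ 1`. [folklore] -/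
private theorem norm_mul_sub_one_le_add {X Y : 𝔹} (hX : ‖X‖ ≤ 1) : ‖X * Y - 1‖ ≤ ‖X - 1‖ + ‖Y - 1‖ := by
  have h : X * Y - 1 = X * (Y - 1) + (X - 1) := by noncomm_ring
  rw [h]
  calc ‖X * (Y - 1) + (X - 1)‖ ≤ ‖X * (Y - 1)‖ + ‖X - 1‖ := norm_add_le _ _
    _ ≤ ‖X‖ * ‖Y - 1‖ + ‖X - 1‖ := by gcongr; exact norm_mul_le _ _
    _ ≤ 1 * ‖Y - 1‖ + ‖X - 1‖ := by gcongr
    _ = ‖X - 1‖ + ‖Y - 1‖ := by ring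

omit [Nontrivial 𝔹] in
/-- For a unitary `A`, `‖A⁻¹ − 1‖ = ‖A − 1‖`. [folklore] -/
private theorem norm_inv_sub_one_eq {A : 𝔹ˣ} (hA : A ∈ unitaryUnits 𝔹) : ‖((A⁻¹ : 𝔹ˣ) : 𝔹) - 1‖ = ‖(A : 𝔹) - 1‖ := by
  have hA' : (A : 𝔹) ∈ unitary 𝔹 := (mem_unitaryUnits).1 hA
  have hinv : ((A⁻¹ : 𝔹ˣ) : 𝔹) = star (A : 𝔹) := by
    have h1 : ((A⁻¹ : 𝔹ˣ) : 𝔹) * (A : 𝔹) = 1 := by rw [← Units.val_mul, inv_mul_cancel, Units.val_one]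
    calc ((A⁻¹ : 𝔹ˣ) : 𝔹) = ((A⁻¹ : 𝔹ˣ) : 𝔹) * ((A : 𝔹) * star (A : 𝔹)) := by rw [Unitary.mul_star_self_of_mem hA', mul_one]
      _ = star (A : 𝔹) := by rw [← mul_assoc, h1, one_mul]
  rw [hinv, ← star_one 𝔹, ← star_sub, norm_star, star_one]

/-- `‖P⁻¹·B·P‖ ≤ ‖B‖` for `P ∈ U1` (both `P`, `P⁻¹` of norm `≤ 1`). [folklore] -/
private theorem norm_conj_le {P : 𝔹ˣ} (hP : P ∈ unitaryUnits 𝔹) (B : 𝔹) : ‖((P⁻¹ : 𝔹ˣ) : 𝔹) * B * (P : 𝔹)‖ ≤ ‖B‖ := by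
  obtain ⟨h1, h2⟩ := (mem_U1).1 (unitaryUnits_le_U1 hP)
  calc ‖((P⁻¹ : 𝔹ˣ) : 𝔹) * B * (P : 𝔹)‖ ≤ ‖((P⁻¹ : 𝔹ˣ) : 𝔹)‖ * ‖B‖ * ‖(P : 𝔹)‖ := by
        refine (norm_mul_le _ _).trans ?_; gcongr; exact norm_mul_le _ _
    _ ≤ 1 * ‖B‖ * 1 := by gcongr
    _ = ‖B‖ := by ring

/-! ## §1  Unitary telescoping along a straight segment -/

/-- ★ **SEGMENT TELESCOPING**: if `u` is unitary at the points `x + t·e_μ`, `t ≤ m`, and each fine bond of the segment has `‖u(x + t·e_μ)⁻¹·u(x + (t+1)·e_μ) − 1‖ ≤ δ`, then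
`‖u(x)⁻¹·u(x + m·e_μ) − 1‖ ≤ m·δ`. [cite: Balaban1985Averaging, (180)–(182) p.46 (bond condition ⇒ quantity along a contour); Balaban1985RegularSpaces, (1.135) p.99] -/
theorem norm_inv_mul_sub_one_le_of_segment (u : SiteZ d → 𝔹ˣ) (x : SiteZ d) (μ : Fin d) {δ : ℝ} :
    ∀ m : ℕ, (∀ t : ℕ, t ≤ m → u (x + (t : ℤ) • e μ) ∈ unitaryUnits 𝔹) →
      (∀ t : ℕ, t < m → ‖((((u (x + (t : ℤ) • e μ))⁻¹ * u (x + ((t : ℤ) + 1) • e μ) : 𝔹ˣ)) : 𝔹) - 1‖ ≤ δ) →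
      ‖((((u x)⁻¹ * u (x + (m : ℤ) • e μ) : 𝔹ˣ)) : 𝔹) - 1‖ ≤ (m : ℝ) * δ := by
  intro m
  induction m with
  | zero =>
    intro _ _
    simp only [Nat.cast_zero, zero_smul, add_zero, inv_mul_cancel, Units.val_one, sub_self, norm_zero, zero_mul, le_refl]
  | succ m ih =>
    intro hu hδ
    have h1 := ih (fun t ht => hu t (Nat.le_succ_of_le ht)) (fun t ht => hδ t (Nat.lt_succ_of_lt ht))
    have h2 := hδ m (Nat.lt_succ_self m)
    have hU : (u x)⁻¹ * u (x + (m : ℤ) • e μ) ∈ unitaryUnits 𝔹 :=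
      (unitaryUnits 𝔹).mul_mem ((unitaryUnits 𝔹).inv_mem (by simpa using hu 0 (Nat.zero_le _))) (hu m (Nat.le_succ m))
    have hprod : (u x)⁻¹ * u (x + ((m + 1 : ℕ) : ℤ) • e μ) =
        ((u x)⁻¹ * u (x + (m : ℤ) • e μ)) * ((u (x + (m : ℤ) • e μ))⁻¹ * u (x + ((m : ℤ) + 1) • e μ)) := by
      rw [show (((m + 1 : ℕ) : ℤ)) = (m : ℤ) + 1 by push_cast; ring]; group
    rw [hprod, Units.val_mul, Nat.cast_succ, add_mul, one_mul]
    exact (norm_mul_sub_one_le_add (unitaryUnits_le_U1 hU).1).trans (add_le_add h1 h2)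

/-- ★ **SEGMENT TELESCOPING, WEIGHTED**: per-bond letters `δ t` along the segment ⇒ `‖u(x)⁻¹·u(x + m·e_μ) − 1‖ ≤ Σ_{t<m} δ t` (for face-level-dependent bond letters of a
hierarchical axial gauge). [cite: Balaban1985Averaging, (180)–(182) p.46; Balaban1985RegularSpaces, (1.135) p.99] -/
theorem norm_inv_mul_sub_one_le_sum_of_segment (u : SiteZ d → 𝔹ˣ) (x : SiteZ d) (μ : Fin d) (δ : ℕ → ℝ) :
    ∀ m : ℕ, (∀ t : ℕ, t ≤ m → u (x + (t : ℤ) • e μ) ∈ unitaryUnits 𝔹) →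
      (∀ t : ℕ, t < m → ‖((((u (x + (t : ℤ) • e μ))⁻¹ * u (x + ((t : ℤ) + 1) • e μ) : 𝔹ˣ)) : 𝔹) - 1‖ ≤ δ t) →
      ‖((((u x)⁻¹ * u (x + (m : ℤ) • e μ) : 𝔹ˣ)) : 𝔹) - 1‖ ≤ ∑ t ∈ Finset.range m, δ t := by
  intro m
  induction m with
  | zero =>
    intro _ _
    simp only [Nat.cast_zero, zero_smul, add_zero, inv_mul_cancel, Units.val_one, sub_self, norm_zero, Finset.range_zero, Finset.sum_empty, le_refl]
  | succ m ih =>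
    intro hu hδ
    have h1 := ih (fun t ht => hu t (Nat.le_succ_of_le ht)) (fun t ht => hδ t (Nat.lt_succ_of_lt ht))
    have h2 := hδ m (Nat.lt_succ_self m)
    have hU : (u x)⁻¹ * u (x + (m : ℤ) • e μ) ∈ unitaryUnits 𝔹 :=
      (unitaryUnits 𝔹).mul_mem ((unitaryUnits 𝔹).inv_mem (by simpa using hu 0 (Nat.zero_le _))) (hu m (Nat.le_succ m))
    have hprod : (u x)⁻¹ * u (x + ((m + 1 : ℕ) : ℤ) • e μ) =
        ((u x)⁻¹ * u (x + (m : ℤ) • e μ)) * ((u (x + (m : ℤ) • e μ))⁻¹ * u (x + ((m : ℤ) + 1) • e μ)) := by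
      rw [show (((m + 1 : ℕ) : ℤ)) = (m : ℤ) + 1 by push_cast; ring]; group
    rw [hprod, Units.val_mul, Finset.sum_range_succ]
    exact (norm_mul_sub_one_le_add (unitaryUnits_le_U1 hU).1).trans (add_le_add h1 h2)

/-! ## §2  The per-bond letter from a gauge relation `F = W^{u⁻¹}` -/

/-- ★★ **BOND LETTER FROM THE GAUGE RELATION** ([6] p. 99 «`U₁ = U₀″^{u⁻¹}`», [3] (8)): `(W^{u⁻¹})(x,μ) = u(x)⁻¹·W(x,μ)·u(x + e_μ)`, hence for unitary `u(x)`, `W(x,μ)`: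
`‖u(x)⁻¹·u(x + e_μ) − 1‖ ≤ ‖W(x,μ) − 1‖ + ‖(W^{u⁻¹})(x,μ) − 1‖`. [cite: Balaban1985RegularSpaces, (1.135) p.99; Balaban1985Averaging, (8) p.18] -/
theorem norm_inv_mul_shift_sub_one_le_of_gaugeAct (u : SiteZ d → 𝔹ˣ) (W : SiteZ d → Fin d → 𝔹ˣ) (x : SiteZ d) (μ : Fin d)
    (hux : u x ∈ unitaryUnits 𝔹) (hW : W x μ ∈ unitaryUnits 𝔹) :
    ‖((((u x)⁻¹ * u (x + e μ) : 𝔹ˣ)) : 𝔹) - 1‖ ≤ ‖((W x μ : 𝔹ˣ) : 𝔹) - 1‖ + ‖((gaugeAct u⁻¹ W x μ : 𝔹ˣ) : 𝔹) - 1‖ := by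
  have hga : gaugeAct u⁻¹ W x μ = (u x)⁻¹ * W x μ * u (x + e μ) := by
    simp only [gaugeAct, Pi.inv_apply, inv_inv]
  have hprod : (u x)⁻¹ * u (x + e μ) = ((u x)⁻¹ * (W x μ)⁻¹ * u x) * gaugeAct u⁻¹ W x μ := by rw [hga]; group
  have hX1 : (u x)⁻¹ * (W x μ)⁻¹ * u x ∈ unitaryUnits 𝔹 :=
    (unitaryUnits 𝔹).mul_mem ((unitaryUnits 𝔹).mul_mem ((unitaryUnits 𝔹).inv_mem hux) ((unitaryUnits 𝔹).inv_mem hW)) hux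
  have hXsub : ‖((((u x)⁻¹ * (W x μ)⁻¹ * u x : 𝔹ˣ)) : 𝔹) - 1‖ ≤ ‖((W x μ : 𝔹ˣ) : 𝔹) - 1‖ := by
    have hid : ((((u x)⁻¹ * (W x μ)⁻¹ * u x : 𝔹ˣ)) : 𝔹) - 1 = (((u x)⁻¹ : 𝔹ˣ) : 𝔹) * ((((W x μ)⁻¹ : 𝔹ˣ) : 𝔹) - 1) * ((u x : 𝔹ˣ) : 𝔹) := by
      have hc : (((u x)⁻¹ : 𝔹ˣ) : 𝔹) * ((u x : 𝔹ˣ) : 𝔹) = 1 := by rw [← Units.val_mul, inv_mul_cancel, Units.val_one]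
      have hexp : (((u x)⁻¹ : 𝔹ˣ) : 𝔹) * ((((W x μ)⁻¹ : 𝔹ˣ) : 𝔹) - 1) * ((u x : 𝔹ˣ) : 𝔹) =
          (((u x)⁻¹ : 𝔹ˣ) : 𝔹) * (((W x μ)⁻¹ : 𝔹ˣ) : 𝔹) * ((u x : 𝔹ˣ) : 𝔹) - (((u x)⁻¹ : 𝔹ˣ) : 𝔹) * ((u x : 𝔹ˣ) : 𝔹) := by
        noncomm_ring
      rw [hexp, hc, Units.val_mul, Units.val_mul]
    rw [hid]
    exact (norm_conj_le hux _).trans (le_of_eq (norm_inv_sub_one_eq hW))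
  rw [hprod, Units.val_mul]
  exact (norm_mul_sub_one_le_add (unitaryUnits_le_U1 hX1).1).trans (by linarith [hXsub])

/-! ## §3  Adjacent-centre letters from fine-bond letters under the cell -/

omit [Nontrivial 𝔹] in
/-- The straight segment from `Lⁿ·a` towards `Lⁿ·(a + e_μ)` stays under the sub-cell `z` (depth `n+1`) when `a, a + e_μ ∈ B(z)` (centred blocks, `2·c_m + 1 = L^m`).
[cite: Balaban1987RG1, (0.3) p.252 (bookkeeping)] -/
theorem underZ_succ_segment {L : ℕ} (hL : Odd L) {n : ℕ} {z a : SiteZ d} {μ : Fin d} (ha : UnderZ L 1 z a) (ha' : UnderZ L 1 z (a + e μ))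
    {t : ℕ} (ht : t ≤ L ^ n) : UnderZ L (n + 1) z (((L : ℤ) ^ n) • a + (t : ℤ) • e μ) := by
  have hc1 : 2 * (ctrShift L 1 : ℤ) + 1 = (L : ℤ) ^ 1 := by exact_mod_cast two_mul_ctrShift_add_one hL 1
  have hcn : 2 * (ctrShift L (n + 1) : ℤ) + 1 = (L : ℤ) ^ (n + 1) := by exact_mod_cast two_mul_ctrShift_add_one hL (n + 1)
  rw [pow_one] at hc1
  rw [pow_succ] at hcn
  have hLn : (1 : ℤ) ≤ (L : ℤ) ^ n := by
    have : 1 ≤ L := hL.pos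
    exact_mod_cast Nat.one_le_pow n L this
  have htn : (t : ℤ) ≤ (L : ℤ) ^ n := by exact_mod_cast ht
  have ht0 : (0 : ℤ) ≤ t := by positivity
  have hL0 : (0 : ℤ) ≤ (L : ℤ) ^ n := by positivity
  -- `Lⁿ·c₁ ≤ c_{n+1}` (indeed `2c_{n+1} = Lⁿ(2c₁ + 1) − 1`)
  have key : (L : ℤ) ^ n * (ctrShift L 1 : ℤ) ≤ ctrShift L (n + 1) := by nlinarith
  intro i
  obtain ⟨h1, h2⟩ := ha i
  obtain ⟨h3, h4⟩ := ha' i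
  simp only [pow_one] at h1 h2 h3 h4
  simp only [Pi.add_apply, Pi.smul_apply, smul_eq_mul, e_apply] at h3 h4 ⊢
  have hsplit : ((L : ℤ) ^ n * a i + (t : ℤ) * (if i = μ then 1 else 0)) - (L : ℤ) ^ (n + 1) * z i =
      (L : ℤ) ^ n * (a i - L * z i) + (t : ℤ) * (if i = μ then 1 else 0) := by ring
  rw [hsplit]
  have hlo : -((L : ℤ) ^ n * (ctrShift L 1 : ℤ)) ≤ (L : ℤ) ^ n * (a i - L * z i) := by nlinarith
  by_cases hi : i = μ
  · subst hi
    simp only [if_true, mul_one] at h3 h4 ⊢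
    have h4' : a i - L * z i ≤ (ctrShift L 1 : ℤ) - 1 := by linarith
    have hup : (L : ℤ) ^ n * (a i - L * z i) ≤ (L : ℤ) ^ n * (ctrShift L 1 : ℤ) - (L : ℤ) ^ n := by nlinarith
    constructor <;> linarith
  · simp only [hi, if_false, mul_zero, add_zero] at h3 h4 ⊢
    have hup : (L : ℤ) ^ n * (a i - L * z i) ≤ (L : ℤ) ^ n * (ctrShift L 1 : ℤ) := by nlinarith
    constructor <;> linarith

/-- ★★ **ADJACENT-CENTRE LETTERS FROM FINE-BOND LETTERS**: `u` unitary under the cell `y` (depth `j`) with fine-bond letters `‖u(x)⁻¹u(x + e_μ) − 1‖ ≤ δ` for bonds under `y` ⇒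
✓p755045's `hadj` with `b(n) := Lⁿ·δ`. [cite: Balaban1985Averaging, (167) p.44, (180)–(182) p.46; Balaban1985RegularSpaces, (1.135) p.99; Balaban1987RG1, (0.3) p.252] -/
theorem adjacent_centre_letters_of_fineBonds {L : ℕ} (hL : Odd L) (u : SiteZ d → 𝔹ˣ) (j : ℕ) (y : SiteZ d)
    (hu : ∀ x, UnderZ L j y x → u x ∈ unitaryUnits 𝔹) {δ : ℝ}
    (hfine : ∀ x (μ : Fin d), UnderZ L j y x → UnderZ L j y (x + e μ) → ‖((((u x)⁻¹ * u (x + e μ) : 𝔹ˣ)) : 𝔹) - 1‖ ≤ δ) :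
    ∀ n, n < j → ∀ z, UnderZ L (j - (n + 1)) y z → ∀ a (μ : Fin d), UnderZ L 1 z a → UnderZ L 1 z (a + e μ) →
      ‖((((u (((L : ℤ) ^ n) • a))⁻¹ * u (((L : ℤ) ^ n) • (a + e μ)) : 𝔹ˣ)) : 𝔹) - 1‖ ≤ (L : ℝ) ^ n * δ := by
  intro n hn z hz a μ ha ha'
  have hdepth : j - (n + 1) + (n + 1) = j := by omega
  -- every point of the segment is under `y` at depth `j`
  have hseg : ∀ t : ℕ, t ≤ L ^ n → UnderZ L j y (((L : ℤ) ^ n) • a + (t : ℤ) • e μ) := fun t ht => by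
    have h := underZ_add hL hz (underZ_succ_segment hL ha ha' ht)
    rwa [hdepth] at h
  have hend : ((L : ℤ) ^ n) • (a + e μ) = ((L : ℤ) ^ n) • a + ((L ^ n : ℕ) : ℤ) • e μ := by
    rw [smul_add]; push_cast; rfl
  rw [hend]
  have h := norm_inv_mul_sub_one_le_of_segment u (((L : ℤ) ^ n) • a) μ (δ := δ) (L ^ n)
    (fun t ht => hu _ (hseg t ht))
    (fun t ht => by
      have h1 := hseg t ht.le
      have h2 := hseg (t + 1) ht
      have heq : ((L : ℤ) ^ n) • a + (t : ℤ) • e μ + e μ = ((L : ℤ) ^ n) • a + (((t + 1 : ℕ)) : ℤ) • e μ := by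
        push_cast; rw [add_smul, one_smul, add_assoc]
      have h3 := hfine _ μ h1 (by rw [heq]; exact h2)
      rwa [heq, show (((t + 1 : ℕ)) : ℤ) = (t : ℤ) + 1 by push_cast; ring] at h3)
  simpa using h

/-- ★★ **ADJACENT-CENTRE LETTERS FROM WEIGHTED FINE-BOND LETTERS**: with a per-bond weight `wt(x, μ)` dominating `‖u(x)⁻¹u(x + e_μ) − 1‖` under the cell and level letters
`b(n)` dominating the weight sums along the straight segments between adjacent level-`n` centres inside a sub-cell, ✓p755045's `hadj` holds with `b` — the face-counting form for a
hierarchical axial gauge whose bond letters depend on the level of the face crossed. [cite: Balaban1985Averaging, (167) p.44, (180)–(182) p.46; Balaban1985RegularSpaces, (1.135) p.99; Balaban1987RG1, (0.3) p.252] -/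
theorem adjacent_centre_letters_of_weightedFineBonds {L : ℕ} (hL : Odd L) (u : SiteZ d → 𝔹ˣ) (j : ℕ) (y : SiteZ d)
    (hu : ∀ x, UnderZ L j y x → u x ∈ unitaryUnits 𝔹) (wt : SiteZ d → Fin d → ℝ)
    (hfine : ∀ x (μ : Fin d), UnderZ L j y x → UnderZ L j y (x + e μ) → ‖((((u x)⁻¹ * u (x + e μ) : 𝔹ˣ)) : 𝔹) - 1‖ ≤ wt x μ)
    (b : ℕ → ℝ)
    (hsum : ∀ n, n < j → ∀ z, UnderZ L (j - (n + 1)) y z → ∀ a (μ : Fin d), UnderZ L 1 z a → UnderZ L 1 z (a + e μ) →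
      ∑ t ∈ Finset.range (L ^ n), wt (((L : ℤ) ^ n) • a + (t : ℤ) • e μ) μ ≤ b n) :
    ∀ n, n < j → ∀ z, UnderZ L (j - (n + 1)) y z → ∀ a (μ : Fin d), UnderZ L 1 z a → UnderZ L 1 z (a + e μ) →
      ‖((((u (((L : ℤ) ^ n) • a))⁻¹ * u (((L : ℤ) ^ n) • (a + e μ)) : 𝔹ˣ)) : 𝔹) - 1‖ ≤ b n := by
  intro n hn z hz a μ ha ha'
  have hdepth : j - (n + 1) + (n + 1) = j := by omega
  have hseg : ∀ t : ℕ, t ≤ L ^ n → UnderZ L j y (((L : ℤ) ^ n) • a + (t : ℤ) • e μ) := fun t ht => by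
    have h := underZ_add hL hz (underZ_succ_segment hL ha ha' ht)
    rwa [hdepth] at h
  have hend : ((L : ℤ) ^ n) • (a + e μ) = ((L : ℤ) ^ n) • a + ((L ^ n : ℕ) : ℤ) • e μ := by
    rw [smul_add]; push_cast; rfl
  rw [hend]
  refine le_trans ?_ (hsum n hn z hz a μ ha ha')
  exact norm_inv_mul_sub_one_le_sum_of_segment u (((L : ℤ) ^ n) • a) μ (fun t => wt (((L : ℤ) ^ n) • a + (t : ℤ) • e μ) μ) (L ^ n)
    (fun t ht => hu _ (hseg t ht))
    (fun t ht => by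
      have h1 := hseg t ht.le
      have h2 := hseg (t + 1) ht
      have heq : ((L : ℤ) ^ n) • a + (t : ℤ) • e μ + e μ = ((L : ℤ) ^ n) • a + (((t + 1 : ℕ)) : ℤ) • e μ := by
        push_cast; rw [add_smul, one_smul, add_assoc]
      have h3 := hfine _ μ h1 (by rw [heq]; exact h2)
      rwa [heq, show (((t + 1 : ℕ)) : ℤ) = (t : ℤ) + 1 by push_cast; ring] at h3)

/-! ## §4  Fine-bond letters ⇒ the pointwise multiscale oscillation `hptu` -/

/-- ★★★ **`hptu` FROM FINE-BOND LETTERS** (`L = 2s+1`, `1 ≤ s`): `u` unitary under the cell `y` (depth `j`), fine-bond letters `δ ≥ 0` under `y` ⇒ for `i < j`, `z` under `y` at depth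
`j − (i+1)` and `w` under `z`: `‖u(L^{i+1}·z)⁻¹·u(w) − 1‖ ≤ ω·θ^{j−(i+1)}` with `ω := 2·d·s·δ·L^{j−1}`, `θ := L⁻¹` — ✓p755045 at `b(n) := Lⁿ·δ`.
[cite: Balaban1985RegularSpaces, (1.135) p.99; Balaban1985Averaging, (166)–(167) p.44, (180)–(182) p.46; Balaban1987RG1, (0.3) p.252] -/
theorem pointwise_osc_of_fineBonds {L s : ℕ} (hLs : L = 2 * s + 1) (hs : 1 ≤ s) (u : SiteZ d → 𝔹ˣ) (j : ℕ) (y : SiteZ d)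
    (hu : ∀ x, UnderZ L j y x → u x ∈ unitaryUnits 𝔹) {δ : ℝ} (hδ : 0 ≤ δ)
    (hfine : ∀ x (μ : Fin d), UnderZ L j y x → UnderZ L j y (x + e μ) → ‖((((u x)⁻¹ * u (x + e μ) : 𝔹ˣ)) : 𝔹) - 1‖ ≤ δ) :
    ∀ i, i < j → ∀ z, UnderZ L (j - (i + 1)) y z → ∀ w, UnderZ L (i + 1) z w →
      ‖((((u (((L : ℤ) ^ (i + 1)) • z))⁻¹ * u w : 𝔹ˣ)) : 𝔹) - 1‖ ≤ (2 * d * s * δ * (L : ℝ) ^ (j - 1)) * ((L : ℝ)⁻¹) ^ (j - (i + 1)) := by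
  have hL : Odd L := ⟨s, hLs⟩
  have h3L : 3 ≤ L := by omega
  have hL3 : (3 : ℝ) ≤ L := by exact_mod_cast h3L
  have hLpos : (0 : ℝ) < L := by linarith
  have hθ0 : (0 : ℝ) ≤ (L : ℝ)⁻¹ := inv_nonneg.2 hLpos.le
  have hθ : (L : ℝ)⁻¹ ≤ 1 / 2 := by rw [inv_le_comm₀ hLpos (by norm_num)]; linarith
  have hω0 : 0 ≤ 2 * d * s * δ * (L : ℝ) ^ (j - 1) := by positivity
  refine pointwise_osc_of_adjacent_centres hLs u j y hu (fun n => (L : ℝ) ^ n * δ) (fun n => by positivity) hθ0 hθ hω0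
    (adjacent_centre_letters_of_fineBonds hL u j y hu hfine) ?_
  -- the geometric schedule: `d·s·(Lⁿδ) = (ω∕2)·θ^{j−(n+1)}` for `ω = 2dsδL^{j−1}`, `θ = L⁻¹`
  intro n hn
  have hsplit : (L : ℝ) ^ (j - 1) = (L : ℝ) ^ n * (L : ℝ) ^ (j - (n + 1)) := by rw [← pow_add]; congr 1; omega
  have hLk : (0 : ℝ) < (L : ℝ) ^ (j - (n + 1)) := by positivity
  rw [hsplit, inv_pow]
  have : 2 * (d : ℝ) * s * δ * ((L : ℝ) ^ n * (L : ℝ) ^ (j - (n + 1))) / 2 * ((L : ℝ) ^ (j - (n + 1)))⁻¹ = d * s * ((L : ℝ) ^ n * δ) := by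
    field_simp
  rw [this]

/-! ## §5  A block-constant left factor does not change the oscillation under the cell -/

omit [Nontrivial 𝔹] in
/-- ★★ **BLOCK-CONSTANT LEFT FACTOR**: if `h = X` on the tower under `y` (depth `j`), then for `z` under `y` at depth `j − (i+1)` and `w` under `z`:
`(h·um)(L^{i+1}z)⁻¹·(h·um)(w) = um(L^{i+1}z)⁻¹·um(w)` — both points lie under `y`. [cite: Balaban1985RegularSpaces, (1.29) p.81, (1.135) p.99; Balaban1987RG1, (0.3) p.252] -/
theorem inv_mul_eq_of_blockConstant {L : ℕ} (hL : Odd L) (h um : SiteZ d → 𝔹ˣ) {j : ℕ} {y : SiteZ d} {X : 𝔹ˣ}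
    (hconst : ∀ x, UnderZ L j y x → h x = X) {i : ℕ} (hi : i < j) {z : SiteZ d} (hz : UnderZ L (j - (i + 1)) y z) {w : SiteZ d} (hw : UnderZ L (i + 1) z w) :
    ((h * um) (((L : ℤ) ^ (i + 1)) • z))⁻¹ * (h * um) w = (um (((L : ℤ) ^ (i + 1)) • z))⁻¹ * um w := by
  have hdepth : j - (i + 1) + (i + 1) = j := by omega
  have hc : UnderZ L j y (((L : ℤ) ^ (i + 1)) • z) := by
    have h := underZ_add hL hz (underZ_pow_smul L (i + 1) z); rwa [hdepth] at h
  have hw' : UnderZ L j y w := by have h := underZ_add hL hz hw; rwa [hdepth] at h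
  rw [Pi.mul_apply, Pi.mul_apply, hconst _ hc, hconst _ hw', mul_inv_rev]
  group

/-- ★★★ **`hptu` FOR `u₀ = h·um` FROM THE GAUGE RELATION's BOND LETTERS** ((σ1) of the K0-road junction, [6] (1.135)): under the cell `y` (depth `j`, `L = 2s+1 ≥ 3`) let `um`, `W`
be unitary, with the two fine-bond letters `‖W(x,μ) − 1‖ ≤ δ_W` and `‖(W^{um⁻¹})(x,μ) − 1‖ ≤ δ_F` for bonds under `y`, and `h` block-constant on the tower under `y`;
then `u₀ := h·um` satisfies ✓p753816's pointwise hypothesis: `‖u₀(L^{i+1}z)⁻¹u₀(w) − 1‖ ≤ ω·θ^{j−(i+1)}`, `ω := 2·d·s·(δ_W + δ_F)·L^{j−1}`, `θ := L⁻¹`.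
[cite: Balaban1985RegularSpaces, (1.135) p.99, (1.29) p.81; Balaban1985Averaging, (8) p.18, (166)–(167) p.44, (180)–(182) p.46; Balaban1987RG1, (0.3) p.252] -/
theorem pointwise_osc_of_fineBonds_of_gaugeAct {L s : ℕ} (hLs : L = 2 * s + 1) (hs : 1 ≤ s) (h um : SiteZ d → 𝔹ˣ) (W : SiteZ d → Fin d → 𝔹ˣ)
    (j : ℕ) (y : SiteZ d) {X : 𝔹ˣ} (hconst : ∀ x, UnderZ L j y x → h x = X)
    (hum : ∀ x, UnderZ L j y x → um x ∈ unitaryUnits 𝔹) (hW : ∀ x (μ : Fin d), UnderZ L j y x → UnderZ L j y (x + e μ) → W x μ ∈ unitaryUnits 𝔹)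
    {δW δF : ℝ} (hδW : 0 ≤ δW) (hδF : 0 ≤ δF)
    (hWb : ∀ x (μ : Fin d), UnderZ L j y x → UnderZ L j y (x + e μ) → ‖((W x μ : 𝔹ˣ) : 𝔹) - 1‖ ≤ δW)
    (hFb : ∀ x (μ : Fin d), UnderZ L j y x → UnderZ L j y (x + e μ) → ‖((gaugeAct um⁻¹ W x μ : 𝔹ˣ) : 𝔹) - 1‖ ≤ δF) :
    ∀ i, i < j → ∀ z, UnderZ L (j - (i + 1)) y z → ∀ w, UnderZ L (i + 1) z w →
      ‖(((((h * um) (((L : ℤ) ^ (i + 1)) • z))⁻¹ * (h * um) w : 𝔹ˣ)) : 𝔹) - 1‖ ≤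
        (2 * d * s * (δW + δF) * (L : ℝ) ^ (j - 1)) * ((L : ℝ)⁻¹) ^ (j - (i + 1)) := by
  have hL : Odd L := ⟨s, hLs⟩
  intro i hi z hz w hw
  rw [inv_mul_eq_of_blockConstant hL h um hconst hi hz hw]
  exact pointwise_osc_of_fineBonds hLs hs um j y hum (add_nonneg hδW hδF)
    (fun x μ hx hx' => (norm_inv_mul_shift_sub_one_le_of_gaugeAct um W x μ (hum x hx) (hW x μ hx hx')).trans
      (add_le_add (hWb x μ hx hx') (hFb x μ hx hx'))) i hi z hz w hw

/-- ★★★ **THE SAME, READ FOR THE CROWN's `u₀` AND THE JUNCTION's `um := h⁻¹·u₀`** (✓p760315's `hJ` data): unitarity of `h⁻¹·u₀` and of `W` under the cell, the bond letters `δ_W` for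
`W` and `δ_F` for `W^{(h⁻¹u₀)⁻¹}` (= `c.fixed V (h⁻¹u₀)` when `W = c.dprime V`, by definition), `h` block-constant under the cell ⇒ `hptu` for `u₀` itself.
[cite: Balaban1985RegularSpaces, (1.135) p.99, (1.29) p.81; Balaban1985Averaging, (166)–(167) p.44; Balaban1987RG1, (0.3) p.252] -/
theorem pointwise_osc_of_fineBonds_precomposed {L s : ℕ} (hLs : L = 2 * s + 1) (hs : 1 ≤ s) (h u₀ : SiteZ d → 𝔹ˣ) (W : SiteZ d → Fin d → 𝔹ˣ)
    (j : ℕ) (y : SiteZ d) {X : 𝔹ˣ} (hconst : ∀ x, UnderZ L j y x → h x = X)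
    (hum : ∀ x, UnderZ L j y x → (h⁻¹ * u₀) x ∈ unitaryUnits 𝔹) (hW : ∀ x (μ : Fin d), UnderZ L j y x → UnderZ L j y (x + e μ) → W x μ ∈ unitaryUnits 𝔹)
    {δW δF : ℝ} (hδW : 0 ≤ δW) (hδF : 0 ≤ δF)
    (hWb : ∀ x (μ : Fin d), UnderZ L j y x → UnderZ L j y (x + e μ) → ‖((W x μ : 𝔹ˣ) : 𝔹) - 1‖ ≤ δW)
    (hFb : ∀ x (μ : Fin d), UnderZ L j y x → UnderZ L j y (x + e μ) → ‖((gaugeAct (h⁻¹ * u₀)⁻¹ W x μ : 𝔹ˣ) : 𝔹) - 1‖ ≤ δF) :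
    ∀ i, i < j → ∀ z, UnderZ L (j - (i + 1)) y z → ∀ w, UnderZ L (i + 1) z w →
      ‖((((u₀ (((L : ℤ) ^ (i + 1)) • z))⁻¹ * u₀ w : 𝔹ˣ)) : 𝔹) - 1‖ ≤
        (2 * d * s * (δW + δF) * (L : ℝ) ^ (j - 1)) * ((L : ℝ)⁻¹) ^ (j - (i + 1)) := by
  have key := pointwise_osc_of_fineBonds_of_gaugeAct hLs hs h (h⁻¹ * u₀) W j y hconst hum hW hδW hδF hWb hFb
  rwa [mul_inv_cancel_left] at key

end Main

end Literature.MathematicalPhysics.QuantumFieldTheory.Balaban1983to89.B8PointwiseOscFromFineBondsRec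

end
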